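import Literature.NumberTheory.LFunctions.ZetaEulerProductMeanSquareUniform
import Literature.NumberTheory.LFunctions.ZetaEulerProductMeanSquare
import HarnessLib

/-!
# Finite Euler products approximate `ζ` in mean square, uniformly on compact `σ`-ranges — proofs

Topic `Literature/NumberTheory/LFunctions`. Everything in this file is PROVED. It discharges the
named fact `Literature.NumberTheory.LFunctions.zeta_sub_finiteEulerProduct_meanSquare_uniform`
(`ZetaEulerProductMeanSquareUniform.lean`; Titchmarsh §11.9, first display, "uniformly for
`σ₀ − δ ≤ σ ≤ σ₁ + δ`"; Bayart–Matheron, proof of Thm. 11.1, "uniformly on compact subsets of `Ω`"):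

* `zeta_sub_finiteEulerProduct_meanSquare_le_uniform` — the tree's fixed-`σ` theorem
  `Literature.NumberTheory.LFunctions.zeta_sub_finiteEulerProduct_meanSquare_le` (integration over
  `[1, T]`) with `P₀` and `T₀(P)` uniform for `σ` in a compact interval `[σ₁, σ₂] ⊂ (1/2, 1]`: the
  very same proof (Euler–Maclaurin of order `ν` with `N ≈ T^a` terms, the smooth-number form of
  the finite Euler product, and the sharp mean value theorem for Dirichlet polynomials), with the
  exponents `a`, `κ`, `ν` chosen from the left end point `σ₁` and every `σ`-dependent quantity
  bounded by its value at `σ₁` (`n^{-2σ} ≤ n^{-2σ₁}`, `N^{2-2σ} ≤ N^{2-2σ₁}`, `T^{-aσ} ≤ T^{-aσ₁}`);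
* `zeta_sub_finiteEulerProduct_meanSquare_uniform_holds` — the fact itself (integration from `0`,
  imaginary shifts `|a| ≤ A`, `σ₂ < 1`): substitute `u = t + a`, bound the integrand on the compact
  rectangle `[σ₁, σ₂] × [−A, 1]` (no pole since `σ₂ < 1`) and use the uniform `[1, T + A]` estimate.

## References

* [Titchmarsh1986] E. C. Titchmarsh, *The Theory of the Riemann Zeta-Function*, 2nd ed., §11.9
  (first display) and §9.17.
* [BayartMatheron2009] F. Bayart, É. Matheron, *Dynamics of Linear Operators*, Thm. 11.1 (proof).
-/

noncomputable section

open Complex Filter Topology MeasureTheory Set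

namespace Literature.NumberTheory.LFunctions

namespace EulerProductMeanSquareUniform

open EulerProductMeanSquare

/-- Tails are monotone in the exponent: `Σ_{k} (k+P)^{-2σ} ≤ Σ_k (k+P)^{-2σ₁}` for `σ₁ ≤ σ`
(`σ₁ > 1/2`). [folklore] -/
theorem tsum_rpow_tail_mono {σ₁ σ : ℝ} (hσ₁ : 1 / 2 < σ₁) (hσ : σ₁ ≤ σ) (P : ℕ) :
    ∑' k : ℕ, ((k + P : ℕ) : ℝ) ^ (-(2 * σ)) ≤ ∑' k : ℕ, ((k + P : ℕ) : ℝ) ^ (-(2 * σ₁)) := by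
  have hs : ∀ σ' : ℝ, 1 / 2 < σ' → Summable fun k : ℕ ↦ ((k + P : ℕ) : ℝ) ^ (-(2 * σ')) :=
    fun σ' hσ' ↦ (Real.summable_nat_rpow.2 (by linarith)).comp_injective (add_left_injective P)
  refine Summable.tsum_le_tsum (fun k ↦ ?_) (hs σ (by linarith)) (hs σ₁ hσ₁)
  rcases Nat.eq_zero_or_pos (k + P) with h0 | hpos
  · rw [h0, Nat.cast_zero, Real.zero_rpow (by linarith), Real.zero_rpow (by linarith)]
  · have h1 : (1 : ℝ) ≤ ((k + P : ℕ) : ℝ) := by exact_mod_cast hpos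
    exact Real.rpow_le_rpow_of_exponent_le h1 (by linarith)

/-- The smooth tails are monotone in the exponent as well. [folklore] -/
theorem tsum_indicator_smooth_mono {σ₁ σ : ℝ} (hσ₁0 : 0 < σ₁) (hσ : σ₁ ≤ σ) (P L : ℕ) :
    ∑' k : ℕ, (P.smoothNumbers).indicator (fun n : ℕ ↦ (n : ℝ) ^ (-σ)) (k + L) ≤
      ∑' k : ℕ, (P.smoothNumbers).indicator (fun n : ℕ ↦ (n : ℝ) ^ (-σ₁)) (k + L) := by
  have hs : ∀ σ' : ℝ, 0 < σ' → Summable fun k : ℕ ↦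
      (P.smoothNumbers).indicator (fun n : ℕ ↦ (n : ℝ) ^ (-σ')) (k + L) := fun σ' hσ' ↦
    (summable_indicator_smoothNumbers_rpow hσ' P).comp_injective (add_left_injective L)
  refine Summable.tsum_le_tsum (fun k ↦ ?_) (hs σ (by linarith)) (hs σ₁ hσ₁0)
  by_cases hmem : k + L ∈ P.smoothNumbers
  · rw [indicator_of_mem hmem, indicator_of_mem hmem]
    have h1 : (1 : ℝ) ≤ ((k + L : ℕ) : ℝ) := by
      exact_mod_cast Nat.pos_of_ne_zero (Nat.ne_zero_of_mem_smoothNumbers hmem)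
    exact Real.rpow_le_rpow_of_exponent_le h1 (by linarith)
  · rw [indicator_of_notMem hmem, indicator_of_notMem hmem]

/-- **Finite Euler products approximate `ζ` in mean square, uniformly for `σ` in a compact part
of `(1/2, 1]`** (Titchmarsh §11.9, first display: "uniformly for `σ₀ − δ ≤ σ ≤ σ₁ + δ`"). For
`1/2 < σ₁ ≤ σ₂ ≤ 1` and `ε > 0` there is `P₀` such that for every `P ≥ P₀` there is `T₀` with
`∫₁ᵀ |ζ(σ+it) − ∏_{p<P}(1 − p^{−σ−it})⁻¹|² dt ≤ ε T` for all `T ≥ T₀` and all `σ ∈ [σ₁, σ₂]`.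
The proof is the tree's proof of the fixed-`σ` statement with all parameters chosen at `σ₁`.
[cite: Titchmarsh1986, §11.9 (first display) and §9.17] -/
theorem zeta_sub_finiteEulerProduct_meanSquare_le_uniform {σ₁ σ₂ : ℝ} (hσ₁ : 1 / 2 < σ₁)
    (hσ₁₂ : σ₁ ≤ σ₂) (hσ₂ : σ₂ ≤ 1) {ε : ℝ} (hε : 0 < ε) :
    ∃ P₀ : ℕ, ∀ P : ℕ, P₀ ≤ P → ∃ T₀ : ℝ, ∀ T : ℝ, T₀ ≤ T → ∀ σ : ℝ, σ₁ ≤ σ → σ ≤ σ₂ →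
      ∫ t in (1 : ℝ)..T, ‖riemannZeta (σ + t * I) -
          ∏ p ∈ P.primesBelow, (1 - (p : ℂ) ^ (-(σ + t * I : ℂ)))⁻¹‖ ^ 2 ≤ ε * T := by
  have hσ₁0 : 0 < σ₁ := by linarith
  -- exponents `κ₀ = 2 - 2σ₁ < κ < 1/a`, `1 < a`, and the Euler–Maclaurin order `ν`
  obtain ⟨κ₀, hκ₀, hκ₀0, hκ₀1⟩ : ∃ κ₀ : ℝ, κ₀ = 2 - 2 * σ₁ ∧ 0 ≤ κ₀ ∧ κ₀ < 1 :=
    ⟨2 - 2 * σ₁, rfl, by linarith, by linarith⟩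
  obtain ⟨a, ha1, ha2, haκ₀⟩ : ∃ a : ℝ, 1 < a ∧ a ≤ 2 ∧ a * κ₀ < 1 := by
    refine ⟨2 / (1 + κ₀), ?_, ?_, ?_⟩
    · rw [lt_div_iff₀ (by linarith)]; linarith
    · rw [div_le_iff₀ (by linarith)]; linarith
    · rw [div_mul_eq_mul_div, div_lt_one (by linarith)]; linarith
  have ha0 : 0 < a := by linarith
  obtain ⟨κ, hκ0, hκ₀κ, hκ1, haκ⟩ : ∃ κ : ℝ, 0 < κ ∧ κ₀ ≤ κ ∧ κ ≤ 1 ∧ a * κ < 1 := by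
    have h1a : 0 < 1 / a := by positivity
    have h1a1 : 1 / a < 1 := by rw [div_lt_one ha0]; exact ha1
    have hκ₀a : κ₀ < 1 / a := by rw [lt_div_iff₀ ha0]; linarith
    refine ⟨(κ₀ + 1 / a) / 2, by linarith, by linarith, by linarith, ?_⟩
    have : a * ((κ₀ + 1 / a) / 2) = (a * κ₀ + 1) / 2 := by field_simp
    rw [this]; linarith
  obtain ⟨ν, hν1, hνa⟩ : ∃ ν : ℕ, 1 ≤ ν ∧ 1 ≤ 2 * (ν : ℝ) * (a - 1) := by
    refine ⟨⌈1 / (2 * (a - 1))⌉₊ + 1, by omega, ?_⟩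
    have h1 : 1 / (2 * (a - 1)) ≤ ((⌈1 / (2 * (a - 1))⌉₊ + 1 : ℕ) : ℝ) := by
      push_cast; exact (Nat.le_ceil _).trans (by linarith)
    rw [div_le_iff₀ (by linarith)] at h1
    linarith
  -- the Euler–Maclaurin constant `C` (the bound at `σ`, then weakened to `σ₁`)
  obtain ⟨C, hC0, hEMC⟩ : ∃ C : ℝ, 0 ≤ C ∧ ∀ {σ T t : ℝ} {N : ℕ}, σ₁ ≤ σ → σ ≤ 1 →
      2 * (ν : ℝ) + 2 ≤ T → 1 ≤ t → t ≤ T → T ^ a ≤ N → ‖riemannZeta (σ + t * I) -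
        ∑ n ∈ Finset.Ico 1 N, (n : ℂ) ^ (-(σ + t * I : ℂ)) -
        (N : ℂ) ^ (1 - (σ + t * I : ℂ)) / ((σ + t * I : ℂ) - 1)‖ ≤ C * T ^ (-(a * σ₁)) := by
    refine ⟨_, emConst_nonneg ν, fun {σ T t N} hσa hσb hT ht1 htT hN ↦ ?_⟩
    have hT1 : (1 : ℝ) ≤ T := by have : (0 : ℝ) ≤ ν := Nat.cast_nonneg ν; linarith
    refine (norm_zeta_sub_sum_sub_le (by linarith) hσb ha1.le hν1 hνa hT ht1 htT hN).trans ?_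
    refine mul_le_mul_of_nonneg_left ?_ (emConst_nonneg ν)
    exact Real.rpow_le_rpow_of_exponent_le hT1 (by nlinarith)
  -- the tail `τ(P)` at `σ₁` and the choice of `P₀`
  obtain ⟨P₀, hP₀⟩ := eventually_atTop.1
    ((tendsto_tsum_rpow_tail (σ := σ₁)).eventually_lt_const (show (0 : ℝ) < ε / 40 by positivity))
  refine ⟨P₀, fun P hP ↦ ?_⟩
  have hτ : ∑' k : ℕ, ((k + P : ℕ) : ℝ) ^ (-(2 * σ₁)) < ε / 40 := hP₀ P hP
  -- the smooth tail `ρ(L)` at `σ₁`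
  obtain ⟨ρ, hρlim, hρbd⟩ : ∃ ρ : ℕ → ℝ, Tendsto ρ atTop (𝓝 0) ∧ ∀ (L : ℕ) (σ t : ℝ), σ₁ ≤ σ →
      ‖∏ p ∈ P.primesBelow, (1 - (p : ℂ) ^ (-(σ + t * I : ℂ)))⁻¹ -
        ∑ n ∈ Finset.range L, (P.smoothNumbers).indicator
          (fun n : ℕ ↦ (n : ℂ) ^ (-(σ + t * I : ℂ))) n‖ ≤ ρ L := by
    refine ⟨fun L ↦ ∑' k : ℕ, (P.smoothNumbers).indicator (fun n : ℕ ↦ (n : ℝ) ^ (-σ₁)) (k + L),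
      tendsto_sum_nat_add _, fun L σ t hσ ↦ ?_⟩
    have hs : 0 < (σ + t * I : ℂ).re := by simp; linarith
    have h := norm_finiteEulerProduct_sub_sum_le hs P L
    have hre : (σ + t * I : ℂ).re = σ := by simp
    rw [hre] at h
    exact h.trans (tsum_indicator_smooth_mono hσ₁0 hσ P L)
  have hρ0 : ∀ L : ℕ, 0 ≤ ρ L := fun L ↦ (norm_nonneg _).trans (hρbd L σ₁ 0 le_rfl)
  -- the choice of `T₀`
  have hNlim : Tendsto (fun T : ℝ ↦ ⌊T ^ a⌋₊ + 1) atTop atTop :=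
    (tendsto_add_atTop_nat 1).comp (tendsto_nat_floor_atTop.comp (tendsto_rpow_atTop ha0))
  have eρ : ∀ᶠ T : ℝ in atTop, ρ (⌊T ^ a⌋₊ + 1) < min 1 (ε / 32) :=
    (hρlim.comp hNlim).eventually_lt_const (by positivity)
  have eκ : ∀ᶠ T : ℝ in atTop, 520 / κ * T ^ (-(1 - a * κ)) < ε / 8 := by
    have h := (tendsto_rpow_neg_atTop (show 0 < 1 - a * κ by linarith)).const_mul (520 / κ)
    rw [mul_zero] at h
    exact h.eventually_lt_const (by positivity)
  have eκ₀ : ∀ᶠ T : ℝ in atTop, 8 * T ^ (-(1 - a * κ₀)) < ε / 8 := by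
    have h := (tendsto_rpow_neg_atTop (show 0 < 1 - a * κ₀ by linarith)).const_mul 8
    rw [mul_zero] at h
    exact h.eventually_lt_const (by positivity)
  have eC : ∀ᶠ T : ℝ in atTop, 4 * C ^ 2 * T ^ (-(2 * a * σ₁)) < ε / 8 := by
    have h := (tendsto_rpow_neg_atTop (show 0 < 2 * a * σ₁ by positivity)).const_mul (4 * C ^ 2)
    rw [mul_zero] at h
    exact h.eventually_lt_const (by positivity)
  have eT : ∀ᶠ T : ℝ in atTop, max (2 * (ν : ℝ) + 2) 4 ≤ T := eventually_ge_atTop _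
  obtain ⟨T₀, hT₀⟩ := eventually_atTop.1 (eT.and (eρ.and (eκ.and (eκ₀.and eC))))
  refine ⟨T₀, fun T hT σ hσa hσb ↦ ?_⟩
  have hσ0 : 0 < σ := by linarith
  have hσ1 : σ ≤ 1 := hσb.trans hσ₂
  obtain ⟨hTmax, hρT, hκT, hκ₀T, hCT⟩ := hT₀ T hT
  clear hT₀ eT eρ eκ eκ₀ eC hNlim hP₀
  have hTν : 2 * (ν : ℝ) + 2 ≤ T := (le_max_left _ _).trans hTmax
  have hT4 : 4 ≤ T := (le_max_right _ _).trans hTmax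
  have hT1 : 1 ≤ T := by linarith
  have hT0 : 0 < T := by linarith
  -- `N = ⌊T^a⌋ + 1`, written `M + 1`
  obtain ⟨M, hM⟩ : ∃ M : ℕ, M = ⌊T ^ a⌋₊ := ⟨_, rfl⟩
  have hρN : ρ (M + 1) < min 1 (ε / 32) := by rw [hM]; exact hρT
  clear hρT
  have hTa0 : 0 ≤ T ^ a := Real.rpow_nonneg hT0.le a
  have hNa : T ^ a ≤ ((M + 1 : ℕ) : ℝ) := by
    rw [hM]; push_cast; exact (Nat.lt_floor_add_one _).le
  have hN2 : ((M + 1 : ℕ) : ℝ) ≤ 2 * T ^ a := by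
    have hTa1 : 1 ≤ T ^ a := Real.one_le_rpow hT1 ha0.le
    rw [hM]; push_cast; linarith [Nat.floor_le hTa0]
  have hN1 : 1 ≤ M + 1 := by omega
  have hN0 : (0 : ℝ) < ((M + 1 : ℕ) : ℝ) := by positivity
  have hN1r : (1 : ℝ) ≤ ((M + 1 : ℕ) : ℝ) := by exact_mod_cast hN1
  -- real-number consequences, prepared while the context is small
  have hNκ : ((M + 1 : ℕ) : ℝ) ^ κ ≤ 2 * (T ^ (-(1 - a * κ)) * T) := by
    have e : T ^ (-(1 - a * κ)) * T = T ^ (a * κ) := by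
      rw [← Real.rpow_add_one hT0.ne']; congr 1; ring
    rw [e]
    calc ((M + 1 : ℕ) : ℝ) ^ κ ≤ (2 * T ^ a) ^ κ := Real.rpow_le_rpow hN0.le hN2 hκ0.le
      _ = 2 ^ κ * T ^ (a * κ) := by rw [Real.mul_rpow (by norm_num) hTa0, Real.rpow_mul hT0.le]
      _ ≤ 2 * T ^ (a * κ) := by
          refine mul_le_mul_of_nonneg_right ?_ (Real.rpow_nonneg hT0.le _)
          calc (2 : ℝ) ^ κ ≤ 2 ^ (1 : ℝ) := Real.rpow_le_rpow_of_exponent_le (by norm_num) hκ1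
            _ = 2 := Real.rpow_one 2
  have hNκ₀ : ((M + 1 : ℕ) : ℝ) ^ (2 - 2 * σ) ≤ 2 * (T ^ (-(1 - a * κ₀)) * T) := by
    have e : T ^ (-(1 - a * κ₀)) * T = T ^ (a * κ₀) := by
      rw [← Real.rpow_add_one hT0.ne']; congr 1; ring
    rw [e]
    calc ((M + 1 : ℕ) : ℝ) ^ (2 - 2 * σ) ≤ ((M + 1 : ℕ) : ℝ) ^ κ₀ :=
          Real.rpow_le_rpow_of_exponent_le hN1r (by rw [hκ₀]; linarith)
      _ ≤ (2 * T ^ a) ^ κ₀ := Real.rpow_le_rpow hN0.le hN2 hκ₀0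
      _ = 2 ^ κ₀ * T ^ (a * κ₀) := by rw [Real.mul_rpow (by norm_num) hTa0, Real.rpow_mul hT0.le]
      _ ≤ 2 * T ^ (a * κ₀) := by
          refine mul_le_mul_of_nonneg_right ?_ (Real.rpow_nonneg hT0.le _)
          calc (2 : ℝ) ^ κ₀ ≤ 2 ^ (1 : ℝ) := Real.rpow_le_rpow_of_exponent_le (by norm_num) hκ₀1.le
            _ = 2 := Real.rpow_one 2
  have hT2aσ : (C * T ^ (-(a * σ₁))) ^ 2 = C ^ 2 * T ^ (-(2 * a * σ₁)) := by
    rw [mul_pow, ← Real.rpow_two (T ^ (-(a * σ₁))), ← Real.rpow_mul hT0.le]; congr 2; ring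
  have hbook := meanSquare_bookkeeping (C := C) hT4 hκ0 hτ hκT hκ₀T hCT (Real.rpow_nonneg hT0.le _)
    (lt_of_lt_of_le hρN (min_le_right _ _)) (hρ0 _) (lt_of_lt_of_le hρN (min_le_left _ _)) hNκ hNκ₀
  -- the pieces, as functions of `t`
  set N : ℕ := M + 1 with hN_def
  obtain ⟨cD, hcD⟩ : ∃ cD : ℕ → ℂ, cD = (P.smoothNumbers)ᶜ.indicator fun n : ℕ ↦ (n : ℂ) ^ (-(σ : ℂ)) :=
    ⟨_, rfl⟩
  obtain ⟨D, hD⟩ : ∃ D : ℝ → ℂ, D = fun t : ℝ ↦ ∑ n ∈ Finset.Icc 1 M, cD n * (n : ℂ) ^ (-((t : ℂ) * I)) :=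
    ⟨_, rfl⟩
  obtain ⟨Sm, hSm⟩ : ∃ Sm : ℝ → ℂ, Sm = fun t : ℝ ↦ ∑ n ∈ Finset.range N,
      (P.smoothNumbers).indicator (fun n : ℕ ↦ (n : ℂ) ^ (-(σ + t * I : ℂ))) n := ⟨_, rfl⟩
  obtain ⟨S, hS⟩ : ∃ S : ℝ → ℂ, S = fun t : ℝ ↦ ∑ n ∈ Finset.Ico 1 N, (n : ℂ) ^ (-(σ + t * I : ℂ)) :=
    ⟨_, rfl⟩
  obtain ⟨Z, hZ⟩ : ∃ Z : ℝ → ℂ, Z = fun t : ℝ ↦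
      ∏ p ∈ P.primesBelow, (1 - (p : ℂ) ^ (-(σ + t * I : ℂ)))⁻¹ := ⟨_, rfl⟩
  obtain ⟨E₁, hE₁⟩ : ∃ E₁ : ℝ → ℂ, E₁ = fun t : ℝ ↦
      (N : ℂ) ^ (1 - (σ + t * I : ℂ)) / ((σ + t * I : ℂ) - 1) := ⟨_, rfl⟩
  obtain ⟨R, hR⟩ : ∃ R : ℝ → ℂ, R = fun t : ℝ ↦ riemannZeta (σ + t * I) - S t - E₁ t := ⟨_, rfl⟩
  obtain ⟨Rs, hRs⟩ : ∃ Rs : ℝ → ℂ, Rs = fun t : ℝ ↦ Z t - Sm t := ⟨_, rfl⟩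
  have hZt : ∀ t : ℝ, ∏ p ∈ P.primesBelow, (1 - (p : ℂ) ^ (-(σ + t * I : ℂ)))⁻¹ = Z t := by
    intro t; rw [hZ]
  simp_rw [hZt]
  -- the algebraic identity `ζ - Z = D + E₁ + R - Rs`
  have hSSm : ∀ t : ℝ, S t - Sm t = D t := by
    intro t
    have h1 : Sm t = ∑ n ∈ Finset.Ico 1 N,
        (P.smoothNumbers).indicator (fun n : ℕ ↦ (n : ℂ) ^ (-(σ + t * I : ℂ))) n := by
      rw [hSm]
      beta_reduce
      rw [Finset.range_eq_Ico, Finset.sum_eq_sum_Ico_succ_bot hN1,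
        indicator_of_notMem (fun h ↦ Nat.ne_zero_of_mem_smoothNumbers h rfl), zero_add]
    have h2 : Finset.Ico 1 N = Finset.Icc 1 M := rfl
    rw [h1, hS, hD]
    beta_reduce
    rw [← Finset.sum_sub_distrib, h2]
    refine Finset.sum_congr rfl fun n hn ↦ ?_
    rw [Finset.mem_Icc] at hn
    have hn0 : (n : ℂ) ≠ 0 := by exact_mod_cast (show n ≠ 0 by omega)
    have hsplit : (n : ℂ) ^ (-(σ + t * I : ℂ)) =
        (n : ℂ) ^ (-(σ : ℂ)) * (n : ℂ) ^ (-((t : ℂ) * I)) := by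
      rw [← Complex.cpow_add _ _ hn0]; congr 1; ring
    by_cases hmem : n ∈ P.smoothNumbers
    · rw [indicator_of_mem hmem, hcD, indicator_of_notMem (Set.notMem_compl_iff.2 hmem), zero_mul,
        sub_self]
    · rw [indicator_of_notMem hmem, hcD, indicator_of_mem (mem_compl hmem), sub_zero, hsplit]
  have hident : ∀ t : ℝ, riemannZeta (σ + t * I) - Z t = D t + E₁ t + R t - Rs t := by
    intro t; rw [← hSSm t, hR, hRs]; ring
  -- pointwise bounds on `[1, T]` (all at the exponent `σ₁`)
  have hcD_norm : ∀ n : ℕ, ‖cD n‖ ^ 2 ≤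
      (P.smoothNumbers)ᶜ.indicator (fun n : ℕ ↦ (n : ℝ) ^ (-(2 * σ₁))) n := by
    intro n
    by_cases hmem : n ∈ (P.smoothNumbers)ᶜ
    · rw [hcD, indicator_of_mem hmem, indicator_of_mem hmem]
      rcases Nat.eq_zero_or_pos n with rfl | hn
      · have hne : (-(σ : ℂ)) ≠ 0 := by simpa using hσ0.ne'
        simp only [Nat.cast_zero]
        rw [Complex.zero_cpow hne, norm_zero, zero_pow two_ne_zero]
        exact Real.rpow_nonneg le_rfl _
      · rw [PartialEuler.norm_natCast_cpow_neg hn, ofReal_re, ← Real.rpow_natCast,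
          ← Real.rpow_mul (Nat.cast_nonneg n)]
        push_cast
        rw [show -σ * 2 = -(2 * σ) by ring]
        have hn1 : (1 : ℝ) ≤ n := by exact_mod_cast hn
        exact Real.rpow_le_rpow_of_exponent_le hn1 (by linarith)
    · rw [hcD, indicator_of_notMem hmem, indicator_of_notMem hmem, norm_zero, zero_pow two_ne_zero]
  have hR_bd : ∀ t ∈ Icc 1 T, ‖R t‖ ≤ C * T ^ (-(a * σ₁)) := by
    intro t ht; rw [hR, hS, hE₁]; exact hEMC hσa hσ1 hTν ht.1 ht.2 hNa
  have hRs_bd : ∀ t : ℝ, ‖Rs t‖ ≤ ρ N := by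
    intro t; rw [hRs, hZ, hSm]; exact hρbd N σ t hσa
  have hE₁_bd : ∀ t ∈ Icc 1 T, ‖E₁ t‖ ^ 2 ≤ (N : ℝ) ^ (2 - 2 * σ) * t ^ (-2 : ℝ) := by
    intro t ht; rw [hE₁]; exact norm_pole_term_sq_le ht.1 hN1
  -- the majorant `g`
  obtain ⟨g, hg⟩ : ∃ g : ℝ → ℝ, g = fun t : ℝ ↦ 4 * ‖D t‖ ^ 2 +
      4 * (N : ℝ) ^ (2 - 2 * σ) * t ^ (-2 : ℝ) + 4 * ((C * T ^ (-(a * σ₁))) ^ 2 + ρ N ^ 2) :=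
    ⟨_, rfl⟩
  have hfg : ∀ t ∈ Icc 1 T, ‖riemannZeta (σ + t * I) - Z t‖ ^ 2 ≤ g t := by
    intro t ht
    rw [hident t, hg]
    beta_reduce
    refine (norm_add_add_sub_sq_le _ _ _ _).trans ?_
    have h1 := hE₁_bd t ht
    have h2 : ‖R t‖ ^ 2 ≤ (C * T ^ (-(a * σ₁))) ^ 2 :=
      pow_le_pow_left₀ (norm_nonneg _) (hR_bd t ht) 2
    have h3 : ‖Rs t‖ ^ 2 ≤ ρ N ^ 2 := pow_le_pow_left₀ (norm_nonneg _) (hRs_bd t) 2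
    linarith only [h1, h2, h3]
  -- continuity of the majorant
  have hDcont : Continuous D := by
    rw [hD]
    refine continuous_finsetSum _ fun n hn ↦ continuous_const.mul ?_
    rw [Finset.mem_Icc] at hn
    have : (fun t : ℝ ↦ (n : ℂ) ^ (-((t : ℂ) * I))) =
        fun t : ℝ ↦ Complex.exp ((-(t * Real.log n) : ℝ) * I) := by
      funext t; exact natCast_cpow_neg_mul_I (by omega) t
    rw [this]; fun_prop
  have hpow_cont : ContinuousOn (fun t : ℝ ↦ t ^ (-2 : ℝ)) (Icc 1 T) :=
    continuousOn_id.rpow_const fun t ht ↦ Or.inl (lt_of_lt_of_le zero_lt_one ht.1).ne'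
  have hgcont : ContinuousOn g (Icc 1 T) := by
    rw [hg]
    exact ((continuous_const.mul ((continuous_norm.comp hDcont).pow 2)).continuousOn.add
      (continuousOn_const.mul hpow_cont)).add continuousOn_const
  -- integrate: `∫₁ᵀ |ζ - Z|² ≤ ∫₁ᵀ g`
  have hint_g : IntervalIntegrable g volume 1 T := hgcont.intervalIntegrable_of_Icc hT1
  have hstep1 : ∫ t in (1 : ℝ)..T, ‖riemannZeta (σ + t * I) - Z t‖ ^ 2 ≤
      ∫ t in (1 : ℝ)..T, g t := by
    rw [intervalIntegral.integral_of_le hT1, intervalIntegral.integral_of_le hT1]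
    refine integral_mono_of_nonneg (ae_of_all _ fun t ↦ by positivity) hint_g.1 ?_
    rw [Filter.EventuallyLE, ae_restrict_iff' measurableSet_Ioc]
    exact ae_of_all _ fun t ht ↦ hfg t ⟨ht.1.le, ht.2⟩
  -- the mean square of the Dirichlet polynomial `D`
  have hD_meanSq : ∫ t in (1 : ℝ)..T, ‖D t‖ ^ 2 ≤
      5 * T * ∑' k : ℕ, ((k + P : ℕ) : ℝ) ^ (-(2 * σ₁)) + 65 * ((N : ℝ) ^ κ / κ) := by
    have hD_int : IntervalIntegrable (fun t : ℝ ↦ ‖D t‖ ^ 2) volume (-T) T :=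
      ((continuous_norm.comp hDcont).pow 2).intervalIntegrable _ _
    have hmono : ∫ t in (1 : ℝ)..T, ‖D t‖ ^ 2 ≤ ∫ t in (-T)..T, ‖D t‖ ^ 2 :=
      intervalIntegral.integral_mono_interval (by linarith) hT1 le_rfl
        (Filter.Eventually.of_forall fun t ↦ by positivity) hD_int
    have hMVT := DirichletMVT.meanSquare_le_sharp cD M hT4
    rw [hD] at hmono ⊢
    refine hmono.trans (hMVT.trans ?_)
    have hsplit : ∑ n ∈ Finset.Icc 1 M, (5 * T + 65 * n) * ‖cD n‖ ^ 2 =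
        5 * T * ∑ n ∈ Finset.Icc 1 M, ‖cD n‖ ^ 2 +
          65 * ∑ n ∈ Finset.Icc 1 M, n * ‖cD n‖ ^ 2 := by
      rw [Finset.mul_sum, Finset.mul_sum, ← Finset.sum_add_distrib]
      refine Finset.sum_congr rfl fun n _ ↦ by ring
    rw [hsplit]
    -- the diagonal: non-smooth `n` are `≥ P`
    have hdiag : ∑ n ∈ Finset.Icc 1 M, ‖cD n‖ ^ 2 ≤ ∑' k : ℕ, ((k + P : ℕ) : ℝ) ^ (-(2 * σ₁)) := by
      have h1 : ∑ n ∈ Finset.Icc 1 M, ‖cD n‖ ^ 2 ≤ ∑ n ∈ Finset.Icc 1 M,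
          (P.smoothNumbers)ᶜ.indicator (fun n : ℕ ↦ (n : ℝ) ^ (-(2 * σ₁))) n :=
        Finset.sum_le_sum fun n _ ↦ hcD_norm n
      have h2 : ∑ n ∈ Finset.Icc 1 M,
          (P.smoothNumbers)ᶜ.indicator (fun n : ℕ ↦ (n : ℝ) ^ (-(2 * σ₁))) n ≤
            ∑ n ∈ Finset.Ico P N, (n : ℝ) ^ (-(2 * σ₁)) := by
        rw [← Finset.sum_filter_add_sum_filter_not (Finset.Icc 1 M)
            (fun n ↦ n ∈ (P.smoothNumbers)ᶜ),
          Finset.sum_congr rfl (fun n hn ↦ indicator_of_mem (Finset.mem_filter.1 hn).2 _),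
          Finset.sum_congr rfl (fun n hn ↦ indicator_of_notMem (Finset.mem_filter.1 hn).2 _),
          Finset.sum_const_zero, add_zero]
        refine Finset.sum_le_sum_of_subset_of_nonneg (fun n hn ↦ ?_) fun n _ _ ↦ by positivity
        rw [Finset.mem_filter, Finset.mem_Icc] at hn
        rw [Finset.mem_Ico]
        exact ⟨le_of_not_mem_smoothNumbers hn.1.1 hn.2, by omega⟩
      exact h1.trans (h2.trans (sum_Ico_rpow_le_tsum hσ₁ P N))
    -- the off-diagonal: `Σ n · n^{-2σ₁} ≤ Σ n^{κ-1} ≤ M^κ/κ ≤ N^κ/κ`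
    have hoff : ∑ n ∈ Finset.Icc 1 M, (n : ℝ) * ‖cD n‖ ^ 2 ≤ (N : ℝ) ^ κ / κ := by
      have h1 : ∑ n ∈ Finset.Icc 1 M, (n : ℝ) * ‖cD n‖ ^ 2 ≤
          ∑ n ∈ Finset.Icc 1 M, (n : ℝ) ^ (κ - 1) := by
        refine Finset.sum_le_sum fun n hn ↦ ?_
        rw [Finset.mem_Icc] at hn
        have hn1 : (1 : ℝ) ≤ n := Nat.one_le_cast.2 hn.1
        have hn0 : (0 : ℝ) < n := lt_of_lt_of_le zero_lt_one hn1
        have h3 : ‖cD n‖ ^ 2 ≤ (n : ℝ) ^ (-(2 * σ₁)) := by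
          refine (hcD_norm n).trans ?_
          by_cases hmem : n ∈ (P.smoothNumbers)ᶜ
          · rw [indicator_of_mem hmem]
          · rw [indicator_of_notMem hmem]; positivity
        calc (n : ℝ) * ‖cD n‖ ^ 2 ≤ n * (n : ℝ) ^ (-(2 * σ₁)) :=
              mul_le_mul_of_nonneg_left h3 hn0.le
          _ = (n : ℝ) ^ (1 - 2 * σ₁) := by
              rw [show (1 : ℝ) - 2 * σ₁ = 1 + (-(2 * σ₁)) by ring, Real.rpow_add hn0,
                Real.rpow_one]
          _ ≤ (n : ℝ) ^ (κ - 1) :=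
              Real.rpow_le_rpow_of_exponent_le hn1 (by linarith only [hκ₀κ, hκ₀])
      have h2 : (M : ℝ) ^ κ / κ ≤ (N : ℝ) ^ κ / κ := by
        have hMN : (M : ℝ) ≤ N := by exact_mod_cast Nat.le_succ M
        exact div_le_div_of_nonneg_right (Real.rpow_le_rpow (Nat.cast_nonneg M) hMN hκ0.le)
          hκ0.le
      exact h1.trans ((sum_Icc_rpow_sub_one_le hκ0 hκ1 M).trans h2)
    exact add_le_add (mul_le_mul_of_nonneg_left hdiag (by positivity))
      (mul_le_mul_of_nonneg_left hoff (by norm_num))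
  -- the integral of the majorant
  have hE_int : ∫ t in (1 : ℝ)..T, (N : ℝ) ^ (2 - 2 * σ) * t ^ (-2 : ℝ) ≤
      (N : ℝ) ^ (2 - 2 * σ) := by
    rw [intervalIntegral.integral_const_mul]
    exact mul_le_of_le_one_right (Real.rpow_nonneg hN0.le _) (integral_rpow_neg_two_le hT1)
  have hg_int : ∫ t in (1 : ℝ)..T, g t ≤
      4 * (5 * T * ∑' k : ℕ, ((k + P : ℕ) : ℝ) ^ (-(2 * σ₁)) + 65 * ((N : ℝ) ^ κ / κ)) +
        4 * (N : ℝ) ^ (2 - 2 * σ) + (T - 1) * (4 * ((C * T ^ (-(a * σ₁))) ^ 2 + ρ N ^ 2)) := by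
    have hi1 : IntervalIntegrable (fun t : ℝ ↦ 4 * ‖D t‖ ^ 2) volume 1 T :=
      ((continuous_const.mul ((continuous_norm.comp hDcont).pow 2)).intervalIntegrable _ _)
    have hi2 : IntervalIntegrable (fun t : ℝ ↦ 4 * (N : ℝ) ^ (2 - 2 * σ) * t ^ (-2 : ℝ))
        volume 1 T := (continuousOn_const.mul hpow_cont).intervalIntegrable_of_Icc hT1
    have hi3 : IntervalIntegrable (fun _ : ℝ ↦ 4 * ((C * T ^ (-(a * σ₁))) ^ 2 + ρ N ^ 2))
        volume 1 T := intervalIntegrable_const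
    rw [hg, intervalIntegral.integral_add (hi1.add hi2) hi3, intervalIntegral.integral_add hi1 hi2,
      intervalIntegral.integral_const, intervalIntegral.integral_const_mul, smul_eq_mul]
    have e2 : ∫ t in (1 : ℝ)..T, 4 * (N : ℝ) ^ (2 - 2 * σ) * t ^ (-2 : ℝ) =
        4 * ∫ t in (1 : ℝ)..T, (N : ℝ) ^ (2 - 2 * σ) * t ^ (-2 : ℝ) := by
      rw [← intervalIntegral.integral_const_mul]
      exact intervalIntegral.integral_congr fun t _ ↦ by ring
    rw [e2]
    have h4 : (0 : ℝ) ≤ 4 := by norm_num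
    exact add_le_add (add_le_add (mul_le_mul_of_nonneg_left hD_meanSq h4)
      (mul_le_mul_of_nonneg_left hE_int h4)) (le_of_eq (by ring))
  -- conclusion
  rw [hT2aσ] at hg_int
  exact hstep1.trans (hg_int.trans hbook)

/-- `z ↦ ζ(z) − ∏_{p<P}(1 − p^{−z})⁻¹` is continuous on the strip `0 < Re z < 1` (no pole there, and
the local factors do not vanish). [folklore] -/
theorem continuousOn_zeta_sub_eulerProduct (P : ℕ) :
    ContinuousOn (fun z : ℂ ↦ riemannZeta z - ∏ p ∈ P.primesBelow, (1 - (p : ℂ) ^ (-z))⁻¹)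
      {z : ℂ | 0 < z.re ∧ z.re < 1} := by
  intro z hz
  have hne : z ≠ 1 := by intro h; rw [h] at hz; norm_num at hz
  refine ContinuousAt.continuousWithinAt (ContinuousAt.sub ?_ ?_)
  · exact (differentiableAt_riemannZeta hne).continuousAt
  · refine tendsto_finsetProd _ fun p hp ↦ ContinuousAt.inv₀ ?_ ?_
    · have hp0 : (p : ℂ) ≠ 0 := by exact_mod_cast (Nat.prime_of_mem_primesBelow hp).ne_zero
      exact continuousAt_const.sub (continuousAt_id.neg.const_cpow (Or.inl hp0))
    · exact one_sub_prime_cpow_ne_zero (Nat.prime_of_mem_primesBelow hp) (by simpa using hz.1)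

/-- For `0 < σ₁ ≤ σ ≤ σ₂ < 1` the shift function `u ↦ |ζ(σ+iu) − ζ_P(σ+iu)|²` is continuous on
`ℝ`, and it is bounded on `[σ₁, σ₂] × [u₁, u₂]`. [folklore] -/
theorem continuous_zeta_sub_eulerProduct_line {σ : ℝ} (hσ0 : 0 < σ) (hσ1 : σ < 1) (P : ℕ) :
    Continuous fun u : ℝ ↦ ‖riemannZeta (σ + u * I) -
      ∏ p ∈ P.primesBelow, (1 - (p : ℂ) ^ (-(σ + u * I : ℂ)))⁻¹‖ ^ 2 := by
  have hmap : Continuous fun u : ℝ ↦ (σ : ℂ) + u * I := by fun_prop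
  have hin : ∀ u : ℝ, (σ : ℂ) + u * I ∈ {z : ℂ | 0 < z.re ∧ z.re < 1} := by
    intro u; simp [hσ0, hσ1]
  exact (continuous_norm.comp ((continuousOn_zeta_sub_eulerProduct P).comp_continuous hmap hin)).pow 2

/-- A uniform bound for `|ζ(σ+iu) − ζ_P(σ+iu)|²` on a compact rectangle `[σ₁, σ₂] × [u₁, u₂]`
with `0 < σ₁`, `σ₂ < 1`. [folklore] -/
theorem exists_bound_zeta_sub_eulerProduct {σ₁ σ₂ : ℝ} (hσ₁ : 0 < σ₁) (hσ₂ : σ₂ < 1) (P : ℕ)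
    (u₁ u₂ : ℝ) : ∃ B : ℝ, 0 ≤ B ∧ ∀ σ ∈ Icc σ₁ σ₂, ∀ u ∈ Icc u₁ u₂, ‖riemannZeta (σ + u * I) -
      ∏ p ∈ P.primesBelow, (1 - (p : ℂ) ^ (-(σ + u * I : ℂ)))⁻¹‖ ^ 2 ≤ B := by
  have hK : IsCompact (Icc σ₁ σ₂ ×ˢ Icc u₁ u₂) := isCompact_Icc.prod isCompact_Icc
  have hmap : Continuous fun q : ℝ × ℝ ↦ (q.1 : ℂ) + q.2 * I := by fun_prop
  have hmaps : MapsTo (fun q : ℝ × ℝ ↦ (q.1 : ℂ) + q.2 * I) (Icc σ₁ σ₂ ×ˢ Icc u₁ u₂)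
      {z : ℂ | 0 < z.re ∧ z.re < 1} := by
    intro q hq
    simp only [mem_setOf_eq, add_re, ofReal_re, mul_re, I_re, mul_zero, ofReal_im, I_im, mul_one,
      sub_self, add_zero]
    exact ⟨hσ₁.trans_le hq.1.1, hq.1.2.trans_lt hσ₂⟩
  have hc : ContinuousOn (fun q : ℝ × ℝ ↦ ‖riemannZeta (q.1 + q.2 * I) -
      ∏ p ∈ P.primesBelow, (1 - (p : ℂ) ^ (-(q.1 + q.2 * I : ℂ)))⁻¹‖ ^ 2)
      (Icc σ₁ σ₂ ×ˢ Icc u₁ u₂) :=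
    ((continuousOn_zeta_sub_eulerProduct P).comp hmap.continuousOn hmaps).norm.pow 2
  obtain ⟨B, hB⟩ := hK.exists_bound_of_continuousOn hc
  refine ⟨max B 0, le_max_right _ _, fun σ hσ u hu ↦ ?_⟩
  have h := hB (σ, u) ⟨hσ, hu⟩
  rw [Real.norm_of_nonneg (by positivity)] at h
  exact h.trans (le_max_left _ _)

/-- **Discharge of `zeta_sub_finiteEulerProduct_meanSquare_uniform`** (Titchmarsh §11.9, first
display, locally uniform form; Bayart–Matheron, proof of Thm. 11.1): integration from `0` with
imaginary shifts `|a| ≤ A` is reduced, by the substitution `u = t + a`, to the uniform `[1, T+A]`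
estimate `zeta_sub_finiteEulerProduct_meanSquare_le_uniform` plus a bounded contribution from
`u ∈ [−A, 1]`. [cite: Titchmarsh1986, §11.9 (first display)] [cite: BayartMatheron2009, Thm. 11.1 (proof)] -/
theorem _root_.Literature.NumberTheory.LFunctions.zeta_sub_finiteEulerProduct_meanSquare_uniform_holds :
    zeta_sub_finiteEulerProduct_meanSquare_uniform := by
  intro σ₁ σ₂ A ε hσ₁ hσ₁₂ hσ₂ hA hε
  have hσ₁0 : 0 < σ₁ := by linarith
  obtain ⟨P₀, hP₀⟩ := zeta_sub_finiteEulerProduct_meanSquare_le_uniform hσ₁ hσ₁₂ hσ₂.le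
    (half_pos hε)
  refine ⟨P₀, fun P hP ↦ ?_⟩
  obtain ⟨T₀, hT₀⟩ := hP₀ P hP
  obtain ⟨B, hB0, hB⟩ := exists_bound_zeta_sub_eulerProduct hσ₁0 hσ₂ P (-A) 1
  refine ⟨max (max T₀ (1 + A)) (2 * (B * (1 + A)) / ε + A), fun T hT σ hσa hσb a ha ↦ ?_⟩
  have hT₀' : T₀ ≤ T := (le_max_left _ _).trans ((le_max_left _ _).trans hT)
  have hT1A : 1 + A ≤ T := (le_max_right _ _).trans ((le_max_left _ _).trans hT)
  have hTB : 2 * (B * (1 + A)) / ε + A ≤ T := (le_max_right _ _).trans hT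
  obtain ⟨ha1, ha2⟩ := abs_le.1 ha
  have hσ0 : 0 < σ := by linarith
  have hσ1 : σ < 1 := lt_of_le_of_lt hσb hσ₂
  set F : ℝ → ℝ := fun u ↦ ‖riemannZeta (σ + u * I) -
    ∏ p ∈ P.primesBelow, (1 - (p : ℂ) ^ (-(σ + u * I : ℂ)))⁻¹‖ ^ 2 with hF
  have hFc : Continuous F := continuous_zeta_sub_eulerProduct_line hσ0 hσ1 P
  have hF0 : ∀ u, 0 ≤ F u := fun u ↦ by rw [hF]; positivity
  have hFi : ∀ x y : ℝ, IntervalIntegrable F volume x y := fun x y ↦ hFc.intervalIntegrable _ _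
  -- substitute `u = t + a`
  have hsub : ∫ t in (0 : ℝ)..T, ‖riemannZeta (σ + (t + a) * I) -
      ∏ p ∈ P.primesBelow, (1 - (p : ℂ) ^ (-(σ + (t + a) * I : ℂ)))⁻¹‖ ^ 2 =
      ∫ u in a..T + a, F u := by
    have h := intervalIntegral.integral_comp_add_right F a (a := 0) (b := T)
    rw [zero_add] at h
    rw [← h]
    refine intervalIntegral.integral_congr fun t _ ↦ ?_
    simp only [hF]
    push_cast
    ring_nf
  rw [hsub, ← intervalIntegral.integral_add_adjacent_intervals (hFi a 1) (hFi 1 (T + a))]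
  -- the part `u ∈ [a, 1]`
  have h1 : ∫ u in a..1, F u ≤ B * (1 + A) := by
    rcases le_or_gt a 1 with ha | ha
    · calc ∫ u in a..1, F u ≤ ∫ u in (-A)..1, F u :=
            intervalIntegral.integral_mono_interval ha1 ha le_rfl
              (Filter.Eventually.of_forall hF0) (hFi _ _)
        _ ≤ ∫ _ in (-A)..1, B :=
            intervalIntegral.integral_mono_on (by linarith) (hFi _ _) intervalIntegrable_const
              fun u hu ↦ hB σ ⟨hσa, hσb⟩ u hu
        _ = B * (1 + A) := by rw [intervalIntegral.integral_const, smul_eq_mul]; ring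
    · rw [intervalIntegral.integral_symm]
      have : 0 ≤ ∫ u in (1 : ℝ)..a, F u := intervalIntegral.integral_nonneg ha.le fun u _ ↦ hF0 u
      have : 0 ≤ B * (1 + A) := by positivity
      linarith
  -- the part `u ∈ [1, T + a] ⊆ [1, T + A]`
  have h2 : ∫ u in (1 : ℝ)..T + a, F u ≤ ε / 2 * (T + A) := by
    calc ∫ u in (1 : ℝ)..T + a, F u ≤ ∫ u in (1 : ℝ)..T + A, F u :=
          intervalIntegral.integral_mono_interval le_rfl (by linarith) (by linarith)
            (Filter.Eventually.of_forall hF0) (hFi _ _)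
      _ ≤ ε / 2 * (T + A) := by
          have h := hT₀ (T + A) (by linarith) σ hσa hσb
          simpa only [hF] using h
  -- bookkeeping
  have hε2 : 0 < ε / 2 := half_pos hε
  have hkey : B * (1 + A) + ε / 2 * A ≤ ε / 2 * T := by
    have h3 : 2 * (B * (1 + A)) / ε ≤ T - A := by linarith
    rw [div_le_iff₀ hε] at h3
    nlinarith
  linarith

end EulerProductMeanSquareUniform

end Literature.NumberTheory.LFunctions
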